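import Summits.HodgeConjecture.HodgeConjecture.Theorems.F0LD2SoftRoadBricks
import Literature.NumberTheory.GelbartRogawski1991.LocalDoubledTwistedSectionEigenlaw
import Literature.NumberTheory.GelbartRogawski1991.LocalDoubledInvariantFunctionalOfFixedVector
import Literature.NumberTheory.GelbartRogawski1991.LocalDoubledDeltaFunctionalNondegenerate
import Literature.NumberTheory.GelbartRogawski1991.LocalDoubledBlockTypesDualityUndoubled
import Literature.NumberTheory.GelbartRogawski1991.LocalSplittingCMGaloisTransportRigidity
import Literature.NumberTheory.GelbartRogawski1991.LocalKudlaSplittingInjectiveSplit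
import Literature.RepresentationTheory.MoeglinVignerasWaldspurger1987.RankOneThetaAnisotropicPlaneDichotomyCentre
import Literature.RepresentationTheory.MoeglinVignerasWaldspurger1987.RankOneOscillatorMultiplicityOne
import Literature.RepresentationTheory.TwistedCoinvariantsCompactIsotypic
import Literature.NumberTheory.Automorphic.Liu2021.Def411WeilCarriersSurvivalNonsplit
import HarnessLib

/-!
# Crux `HLiu418`, line LD2 — the soft-road brick (Z-Λ): a centre type of the plane's CM Weil representation gives a NON-ZERO
# `U(W ⊕ −W)`-invariant linear functional on `𝒮(L⁺_v^{2+2})` (theorems only)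

Cell `hodgecm-mathlib` (D-0151), half A line LD2, seat B-p04 (g45) for LD2-plan (g3) (DEALS #16 (1), 2026-09-02).  Crux hLiu418 =
`stmt-HodgeConjecture-24832`; organ `LineThetaTypesComplementary₁`; soft-road junction ★ `Theorems/F0LD2SoftRoadBricks.lean`, brick (Z) cut into
(Z-Λ) ∧ (Z-van) (`Theorems/F0LD2SoftRoadZBricks.lean`, B-p04 (g45)).  THEOREMS ONLY (no `def`, no named fact, no instance, no notation, no `sorry`);
`--supports stmt-HodgeConjecture-24832`.  THIS FILE PAYS (Z-Λ): its head `zLambda_body` has the body of `ZLambda` VERBATIM as its type, so the brick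
closes as `theorem zLambda_holds : ZLambda := zLambda_body` once the defs leaf is served.

THE PROOF ([GelbartRogawski1991, §3.2 (3.2.2)–(3.2.3)], doubling see-saw `U(W ⊕ −W) × U(V) ⊂ U((W ⊕ −W) ⊗ V)`; [Weil1965, §9]).  `v` non-split,
`T` the hermitian plane, `s^𝔻 = (localSplittingDatumCM L v μ 2 …).localSplitting` on `𝒮(L⁺_v^{2+2})`, `s_T = localSplittingCMWith L 2 … = undoubleLoc s^𝔻`,
`G₁ = U(⟨1⟩ ⊕ ⟨−1⟩)(L⁺_v)`, ★ `kronLoc : G₁ →* H₂`, twisted section ★ `s′ h = μ_v(det h)⁻¹ • ω^𝔻(s^𝔻(kronLoc h))` (inline).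
§1 the twist on `inl U(W)` IS the centre character (`localMu_det_inlLoc_eq`, ★ `det_inlLoc_apply`, ★ `matS_map_eval`), the centre through `U(⟨1⟩)` or
`U(J′)` (`localCenter_two_comp`); §2 the block law at the centre through `kronLoc` (`toRep_localSplitting_kronLoc_inlLoc_boxSB`: ★ `kronLoc_inlLoc`, ★
`inlLoc_eq_blockSum_inlLoc`, ★ `toRep_undoubleLoc_boxSB`); §3 at an `e′`-EIGENVECTOR `f₁ ≠ 0`: `Φ := f₁ ⊠ f₂` with `λ′(Φ) = 1` (non-degeneracy ★
`eq_zero_of_forall_apply_zero_toRep_boxSB_left_eq_zero`, mover ★ `exists_mover_deltaLagrangian`), `Φ` FIXED by `s′(inl U(W))` (§1–§2: the twist cancels the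
centre type exactly), dock ★ `exists_invariant_functional_of_fixedVector_cm` with ★ `twistedSection_mul` ∕ `apply_zero_toRep_twistedSection_kronLoc_eq_modularCharacter_mul`
∕ `continuous_apply_twistedSection_kronLoc` ⇒ `Λ` invariant with `re Λ(Φ) > 0`; §4 the eigenvector from the coinvariant (★ `TwistedCoinv.exists_mem_weightSpace_mk_eq`,
`U(J′)(L⁺_v)` compact via ★ `compactSpace_localPi_rankOne` + the centre homeomorphism, ★ `isSmooth_localSplittingCMWith`).

HONEST LABEL.  Nothing of print is asserted; this is the (Z-Λ) half only — (Z-van) («every such `Λ` is `0`» for an ANISOTROPIC plane, A-p19 (g31)) is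
what turns it into the soft-road target (Z).  HC_CM is proved only modulo the 7 printed citations (2 remaining: hLiu418 = stmt-HodgeConjecture-24832, h413 =
stmt-HodgeConjecture-24833) until rung 0 closes; count-neutral.

## References
* [GelbartRogawski1991] S. Gelbart, J. Rogawski, Invent. Math. 105 (1991), §3.1 Prop. 3.1.1 p. 455, §3.2 (3.2.2)–(3.2.3) p. 457.
* [WeilIntegration1965] A. Weil, *L'intégration dans les groupes topologiques* (1965), §9.  [Kudla1994] S. Kudla, Israel J. Math. 87 (1994), §3 Thm. 3.1.
* [MoeglinVignerasWaldspurger1987] LNM 1291 (1987), Chap. 2 II.1 (B), Rem. (6).  [BernsteinZelevinsky1976] Russian Math. Surveys 31 (1976), §2.3.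
-/

set_option autoImplicit false
set_option linter.dupNamespace false

noncomputable section

open scoped Matrix Kronecker NNReal
open NumberField IsDedekindDomain MeasureTheory MeasureTheory.Measure
open Literature.NumberTheory Literature.NumberTheory.Automorphic Literature.NumberTheory.Automorphic.UnitaryGroup
open Literature.RepresentationTheory Literature.RepresentationTheory.HeisenbergGroup Literature.RepresentationTheory.TwistedCoinv
open Literature.NumberTheory.GelbartRogawski1991 Literature.NumberTheory.GelbartRogawski1991.UnitaryDualPair
open Literature.NumberTheory.GelbartRogawski1991.UnitaryDualPair.WeilCoinv
open Literature.NumberTheory.GelbartRogawski1991.UnitaryDualPair.LocalSplitting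
open Literature.NumberTheory.GelbartRogawski1991.GRConstruction
open Literature.NumberTheory.Weil1964
open Literature.NumberTheory.GaloisRepresentations Literature.RepresentationTheory.HarrisKudlaSweet1996
open Literature.RepresentationTheory.MoeglinVignerasWaldspurger1987
open Literature.NumberTheory.QuadraticForms

namespace Summit.HodgeConjecture.HodgeConjecture.Cruxes.HLiu418.F0LD2SoftRoadZLambda

variable (L : Type) [Field L] [NumberField L] [IsCMField L] (v : HeightOneSpectrum (𝓞 (maximalRealSubfield L)))

/-! ## §1 Three presentations of the torus `L_v¹` -/
section Presentations
omit [IsCMField L] in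
/-- `(1 ⊗ 1) 0 0 = 1 ≠ 0`: the standard line `⟨1⟩` presents the centre. [folklore] -/
theorem one_map_apply_zero_ne_zero :
    ((1 : Matrix (Fin 1) (Fin 1) (maximalRealSubfield L)).map (algebraMap (maximalRealSubfield L) L)) 0 0 ≠ 0 := by
  rw [Matrix.map_apply, Matrix.one_apply_eq, map_one]
  exact one_ne_zero

/-- the `0 0` entry of the centre presentation `z ↦ z·1₁` of a rank-one element is the entry of `z`. [folklore] -/
theorem localCenter_one_apply_entry {J₁ J' : Matrix (Fin 1) (Fin 1) L} (hJ'0 : J' 0 0 ≠ 0)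
    (z : localPi L (IsCMField.complexConj L) 1 J' v) (w : PlacesOver L v) :
    ((((UnitaryGroup.localCenter L (IsCMField.complexConj L) 1 J₁ J' hJ'0 v z : localPi L (IsCMField.complexConj L) 1 J₁ v) :
        LocalGLPi L 1 v) w : GL (Fin 1) (w.1.adicCompletion L)) : Matrix (Fin 1) (Fin 1) (w.1.adicCompletion L)) 0 0 =
      (((z : LocalGLPi L 1 v) w : GL (Fin 1) (w.1.adicCompletion L)) : Matrix (Fin 1) (Fin 1) (w.1.adicCompletion L)) 0 0 := by
  rw [coe_localCenter_one_one L (IsCMField.complexConj L) J₁ J' hJ'0 v z]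

/-- **rank-one centre maps compose (plane version)**: `U(J′) → U(⟨1⟩) → U(J)` equals `U(J′) → U(J)` — all are `z ↦ z·1`.
[cite: GelbartRogawski1991, §3.2 p. 457] -/
theorem localCenter_two_comp {N : ℕ} (J : Matrix (Fin N) (Fin N) L) {J₁ J' : Matrix (Fin 1) (Fin 1) L} (hJ₁0 : J₁ 0 0 ≠ 0) (hJ'0 : J' 0 0 ≠ 0)
    (z : localPi L (IsCMField.complexConj L) 1 J' v) :
    UnitaryGroup.localCenter L (IsCMField.complexConj L) N J J₁ hJ₁0 v (UnitaryGroup.localCenter L (IsCMField.complexConj L) 1 J₁ J' hJ'0 v z) =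
      UnitaryGroup.localCenter L (IsCMField.complexConj L) N J J' hJ'0 v z := by
  rw [localCenter_one_comp L (IsCMField.complexConj L) N J J₁ J' hJ₁0 hJ'0 v, MonoidHom.comp_apply]

variable (χ : HeckeCharacter L)

/-- **THE TWIST ON `inl U(W)` IS THE CENTRE CHARACTER**: for `u ∈ U(⟨1⟩)(L⁺_v)` embedded as `u ⊕ 1` in the standard doubled line,
`μ_v(det(u ⊕ 1)) = ∏_w χ_w(det((z ↦ z·1)(z′ ↦ z′·1) u)_w)` — the value `e′(u)` of the centre character read through any centre line `J′` (★
`det_inlLoc_apply`: `det (u ⊕ 1)_w = det u_w`; ★ `matS_map_eval`: the matrix of `h` over `E_v` has `w`-component the matrix of `h_w`).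
[cite: GelbartRogawski1991, §3.2 (3.2.2) p. 457] [cite: Kudla1994, §3 Thm. 3.1] -/
theorem localMu_det_inlLoc_eq {JW : Matrix (Fin 1) (Fin 1) L}
    (hJW : JW = (1 : Matrix (Fin 1) (Fin 1) (maximalRealSubfield L)).map (algebraMap (maximalRealSubfield L) L)) (hJW0 : JW 0 0 ≠ 0)
    {JD₁ : Matrix (Fin (1 + 1)) (Fin (1 + 1)) L}
    (hJD₁ : JD₁ = (gramD (maximalRealSubfield L) 1 1).map (algebraMap (maximalRealSubfield L) L))
    {J₁ J' : Matrix (Fin 1) (Fin 1) L} (hJ'0 : J' 0 0 ≠ 0) (u : localPi L (IsCMField.complexConj L) 1 JW v) :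
    localMu L χ v (Matrix.GeneralLinearGroup.det ((localPiEquiv L (IsCMField.complexConj L) (1 + 1) JD₁ v
        (inlLoc (maximalRealSubfield L) L (IsCMField.complexConj L) v 1 hJW hJD₁ u)).1)) =
      ∏ w' : PlacesOver L v, χ.localComponent w'.1 (Matrix.GeneralLinearGroup.det
        (((UnitaryGroup.localCenter L (IsCMField.complexConj L) 1 J₁ J' hJ'0 v
            (UnitaryGroup.localCenter L (IsCMField.complexConj L) 1 J' JW hJW0 v u) : localPi L (IsCMField.complexConj L) 1 J₁ v) :
          LocalGLPi L 1 v) w')) := by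
  rw [localMu_apply]
  refine Finset.prod_congr rfl fun w' _ => ?_
  rw [HeckeCharacter.localComponent_apply]
  -- the two units of `L_{w′}` agree: `det (u ⊕ 1)_{w′} = det u_{w′} = u_{w′,00} = det ((u·1)·1)_{w′}`
  have key : Units.map (Pi.evalMonoidHom (fun w : PlacesOver L v => w.1.adicCompletion L) w')
        (Matrix.GeneralLinearGroup.det ((localPiEquiv L (IsCMField.complexConj L) (1 + 1) JD₁ v
          (inlLoc (maximalRealSubfield L) L (IsCMField.complexConj L) v 1 hJW hJD₁ u)).1)) =
      Matrix.GeneralLinearGroup.det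
        (((UnitaryGroup.localCenter L (IsCMField.complexConj L) 1 J₁ J' hJ'0 v
            (UnitaryGroup.localCenter L (IsCMField.complexConj L) 1 J' JW hJW0 v u) : localPi L (IsCMField.complexConj L) 1 J₁ v) :
          LocalGLPi L 1 v) w') := by
    refine Units.ext ?_
    -- left: the `w′`-component of `det` of the matrix of `u ⊕ 1` over `E_v` is `det (u ⊕ 1)_{w′} = det u_{w′}`
    have hL : ((Units.map (Pi.evalMonoidHom (fun w : PlacesOver L v => w.1.adicCompletion L) w')
          (Matrix.GeneralLinearGroup.det ((localPiEquiv L (IsCMField.complexConj L) (1 + 1) JD₁ v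
            (inlLoc (maximalRealSubfield L) L (IsCMField.complexConj L) v 1 hJW hJD₁ u)).1)) : (w'.1.adicCompletion L)ˣ) :
            w'.1.adicCompletion L) =
        ((Matrix.GeneralLinearGroup.det (((inlLoc (maximalRealSubfield L) L (IsCMField.complexConj L) v 1 hJW hJD₁ u :
            localPi L (IsCMField.complexConj L) (1 + 1) JD₁ v) : LocalGLPi L (1 + 1) v) w') : (w'.1.adicCompletion L)ˣ) :
            w'.1.adicCompletion L) := by
      rw [Units.coe_map, Pi.evalMonoidHom_apply, Matrix.GeneralLinearGroup.val_det_apply, Matrix.GeneralLinearGroup.val_det_apply,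
        ← matS_map_eval (maximalRealSubfield L) L (IsCMField.complexConj L) v 1
          (inlLoc (maximalRealSubfield L) L (IsCMField.complexConj L) v 1 hJW hJD₁ u) w', ← RingHom.mapMatrix_apply, ← RingHom.map_det]
      rfl
    rw [hL, det_inlLoc_apply (maximalRealSubfield L) L (IsCMField.complexConj L) v 1 hJW hJD₁ u w',
      Matrix.GeneralLinearGroup.val_det_apply, Matrix.GeneralLinearGroup.val_det_apply, Matrix.det_fin_one, Matrix.det_fin_one,
      localCenter_one_apply_entry L v hJ'0, localCenter_one_apply_entry L v hJW0]
  rw [key]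

end Presentations

/-! ## §2 The block law at the centre of the plane through the Kronecker embedding -/
section BlockLaw
variable [MeasurableSpace (v.adicCompletion (maximalRealSubfield L))] [BorelSpace (v.adicCompletion (maximalRealSubfield L))]
  (μ : Measure (v.adicCompletion (maximalRealSubfield L))) [μ.IsAddHaarMeasure]
  (χ : HeckeCharacter L) (hχ : IsSplittingChar L 1 χ)
  {T : Matrix (Fin 2) (Fin 2) (maximalRealSubfield L)} (hTs : T.IsSymm) (hTd : IsUnit T.det)

set_option synthInstance.maxHeartbeats 400000 in -- the doubled CM datum's telescope
set_option maxHeartbeats 4000000 in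
/-- **block law at the centre through `kronLoc`**: for `u ∈ U(⟨1⟩)(L⁺_v)`, `ω^𝔻(s^𝔻(kronLoc (u ⊕ 1)))(f₁ ⊠ f₂) = ω_T(s_T(u·1_V)) f₁ ⊠ f₂` (★
`kronLoc_inlLoc`: `(u ⊕ 1) ⊗ₖ 1_V = (u·1_V) ⊕ 1_V`; ★ `toRep_undoubleLoc_boxSB`; `s_T = undoubleLoc s^𝔻` by definition).
[cite: MoeglinVignerasWaldspurger1987, Chap. 2 II.1 Rem. (6)] [cite: GelbartRogawski1991, §3.1 Prop. 3.1.1 p. 455] -/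
theorem toRep_localSplitting_kronLoc_inlLoc_boxSB {JW : Matrix (Fin 1) (Fin 1) L}
    (hJW : JW = (1 : Matrix (Fin 1) (Fin 1) (maximalRealSubfield L)).map (algebraMap (maximalRealSubfield L) L)) (hJW0 : JW 0 0 ≠ 0)
    {JD₁ : Matrix (Fin (1 + 1)) (Fin (1 + 1)) L}
    (hJD₁ : JD₁ = (gramD (maximalRealSubfield L) 1 1).map (algebraMap (maximalRealSubfield L) L))
    (u : localPi L (IsCMField.complexConj L) 1 JW v)
    (f₁ f₂ : SchwartzBruhat (Fin 2 → v.adicCompletion (maximalRealSubfield L))) :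
    MpPsi.toRep (localSchrodinger (maximalRealSubfield L) (2 + 2) (gramD (maximalRealSubfield L) 2 T) v)
        ((localSplittingDatumCM L v μ 2 hTs hTd rfl χ hχ).localSplitting
          (kronLoc (maximalRealSubfield L) L (IsCMField.complexConj L) v 2 (T := T) (J := T.map (algebraMap (maximalRealSubfield L) L))
            rfl rfl hJD₁ (inlLoc (maximalRealSubfield L) L (IsCMField.complexConj L) v 1 hJW hJD₁ u)))
        (boxSB (v.adicCompletion (maximalRealSubfield L)) (e₂ 2) f₁ f₂) =
      boxSB (v.adicCompletion (maximalRealSubfield L)) (e₂ 2)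
        (MpPsi.toRep (localSchrodinger (maximalRealSubfield L) 2 T v)
          (localSplittingCMWith L 2 hTs hTd (J := T.map (algebraMap (maximalRealSubfield L) L)) rfl χ hχ v μ
            (UnitaryGroup.localCenter L (IsCMField.complexConj L) 2 (T.map (algebraMap (maximalRealSubfield L) L)) JW hJW0 v u)) f₁) f₂ := by
  rw [inlLoc_eq_blockSum_inlLoc (maximalRealSubfield L) L (IsCMField.complexConj L) v 1 hJW hJD₁ u,
    kronLoc_inlLoc (maximalRealSubfield L) L (IsCMField.complexConj L) v 2 (T := T) rfl rfl hJD₁ hJW hJD₁ hJW0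
      (T' := -T) rfl,
    ← inlLoc_eq_blockSum_inlLoc (maximalRealSubfield L) L (IsCMField.complexConj L) v 2 (hJ := rfl) (hJD := rfl)]
  exact toRep_undoubleLoc_boxSB (maximalRealSubfield L) L (IsCMField.complexConj L) v 2 rfl rfl (complexConj_imagUnit L) (imagUnit_ne_zero L)
    (imagUnit_mul_self L) hTs hTd (localSplittingDatumCM L v μ 2 hTs hTd rfl χ hχ).localSplitting
    (fun g => (localSplittingDatumCM L v μ 2 hTs hTd rfl χ hχ).proj_localSplitting g) _ f₁ f₂

end BlockLaw

/-! ## §3 The dock at a centre EIGENVECTOR (rank written `2` throughout) -/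
section Dock
variable [MeasurableSpace (v.adicCompletion (maximalRealSubfield L))] [BorelSpace (v.adicCompletion (maximalRealSubfield L))]
  (μ : Measure (v.adicCompletion (maximalRealSubfield L))) [μ.IsAddHaarMeasure]

set_option synthInstance.maxHeartbeats 400000 in
set_option maxHeartbeats 8000000 in -- the doubled CM datum's telescope + the dock
/-- **an `e′`-EIGENVECTOR `f₁ ≠ 0` of `ω_T ∘ s_T ∘ (z ↦ z·1)` gives a NON-ZERO linear functional on `𝒮(L⁺_v^{2+2})` invariant under the twisted section**
(`Φ := f₁ ⊠ f₂` with `λ′(Φ) = 1` by non-degeneracy; `Φ` is `s′(inl U(W))`-fixed by §1–§2; then ★ `exists_invariant_functional_of_fixedVector_cm`).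
[cite: GelbartRogawski1991, §3.2 (3.2.2)–(3.2.3) p. 457] [cite: WeilIntegration1965, §9] [cite: MoeglinVignerasWaldspurger1987, Chap. 2 II.1 (B)] -/
theorem exists_invariant_functional_of_centre_eigenvector (hE : IsField (UnitaryGroup.LocalRing L v))
    {T : Matrix (Fin 2) (Fin 2) (maximalRealSubfield L)} (hTs : T.IsSymm) (hTd : IsUnit T.det)
    (χ : HeckeCharacter L) (hχ : IsSplittingChar L 1 χ) {J₁ J' : Matrix (Fin 1) (Fin 1) L} (hJ'0 : J' 0 0 ≠ 0)
    (e' : localPi L (IsCMField.complexConj L) 1 J' v →* ℂˣ)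
    (he' : ∀ z, e' z = ∏ w' : PlacesOver L v, χ.localComponent w'.1 (Matrix.GeneralLinearGroup.det
      (((UnitaryGroup.localCenter L (IsCMField.complexConj L) 1 J₁ J' hJ'0 v z : localPi L (IsCMField.complexConj L) 1 J₁ v) :
        LocalGLPi L 1 v) w')))
    {JD₁ : Matrix (Fin (1 + 1)) (Fin (1 + 1)) L}
    (hJD₁ : JD₁ = (gramD (maximalRealSubfield L) 1 1).map (algebraMap (maximalRealSubfield L) L))
    (f₁ : SchwartzBruhat (Fin 2 → v.adicCompletion (maximalRealSubfield L))) (hf₁ne : f₁ ≠ 0)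
    (hf₁eig : ∀ z : localPi L (IsCMField.complexConj L) 1 J' v,
      MpPsi.toRep (localSchrodinger (maximalRealSubfield L) 2 T v)
          (localSplittingCMWith L 2 hTs hTd (J := T.map (algebraMap (maximalRealSubfield L) L)) rfl χ hχ v μ
            (UnitaryGroup.localCenter L (IsCMField.complexConj L) 2 (T.map (algebraMap (maximalRealSubfield L) L)) J' hJ'0 v z)) f₁ =
        ((e' z : ℂˣ) : ℂ) • f₁) :
    ∃ Λ : SchwartzBruhat (Fin (2 + 2) → v.adicCompletion (maximalRealSubfield L)) →ₗ[ℂ] ℂ, Λ ≠ 0 ∧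
      ∀ (g : UnitaryGroup.localPi L (IsCMField.complexConj L) (1 + 1) JD₁ v)
        (Ψ : SchwartzBruhat (Fin (2 + 2) → v.adicCompletion (maximalRealSubfield L))),
        Λ ((((localMu L χ v (Matrix.GeneralLinearGroup.det ((localPiEquiv L (IsCMField.complexConj L) (1 + 1) JD₁ v g).1)))⁻¹ : ℂˣ) : ℂ) •
          MpPsi.toRep (localSchrodinger (maximalRealSubfield L) (2 + 2) (gramD (maximalRealSubfield L) 2 T) v)
            ((localSplittingDatumCM L v μ 2 hTs hTd rfl χ hχ).localSplitting
              (kronLoc (maximalRealSubfield L) L (IsCMField.complexConj L) v 2 (T := T) (J := T.map (algebraMap (maximalRealSubfield L) L))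
                rfl rfl hJD₁ g)) Ψ) = Λ Ψ := by
  -- the standard line `⟨1⟩` of `G₁ = U(⟨1⟩ ⊕ ⟨−1⟩)(L⁺_v)` and its centre presentation
  have h1s : (1 : Matrix (Fin 1) (Fin 1) (maximalRealSubfield L)).IsSymm := Matrix.isSymm_one
  have h1d : IsUnit (1 : Matrix (Fin 1) (Fin 1) (maximalRealSubfield L)).det := by
    rw [Matrix.det_one]; exact isUnit_one
  have hJW : (1 : Matrix (Fin 1) (Fin 1) (maximalRealSubfield L)).map (algebraMap (maximalRealSubfield L) L) =
      (1 : Matrix (Fin 1) (Fin 1) (maximalRealSubfield L)).map (algebraMap (maximalRealSubfield L) L) := rfl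
  have hJW0 := one_map_apply_zero_ne_zero L
  -- `U(⟨1⟩)(L⁺_v) = L_v¹` is compact (non-split `v`)
  haveI hcW : CompactSpace (localPi L (IsCMField.complexConj L) 1
      ((1 : Matrix (Fin 1) (Fin 1) (maximalRealSubfield L)).map (algebraMap (maximalRealSubfield L) L)) v) :=
    compactSpace_localPi_rankOne (maximalRealSubfield L) L (IsCMField.complexConj L) (complexConj_imagUnit L) (imagUnit_ne_zero L) h1d hJW v hE
  -- the mover `m₀` (`ℓ_Δ ↦ ℓ_Y`) and the `Δ`-functional `λ′ = ev₀ ∘ ω^𝔻(m₀)`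
  obtain ⟨m₀, hm₀⟩ := exists_mover_deltaLagrangian (maximalRealSubfield L) v 2 hTd
  obtain ⟨lam, hlam⟩ := exists_linearMap_apply_zero_toRep (maximalRealSubfield L) v 2 m₀
  -- non-degeneracy: some `f₂` has `λ′(f₁ ⊠ f₂) ≠ 0`; normalise it to `1`
  have hex : ∃ f₂ : SchwartzBruhat (Fin 2 → v.adicCompletion (maximalRealSubfield L)),
      ((MpPsi.toRep (localSchrodinger (maximalRealSubfield L) (2 + 2) (gramD (maximalRealSubfield L) 2 T) v) m₀
          (boxSB (v.adicCompletion (maximalRealSubfield L)) (e₂ 2) f₁ f₂) :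
            SchwartzBruhat (Fin (2 + 2) → v.adicCompletion (maximalRealSubfield L))) :
          (Fin (2 + 2) → v.adicCompletion (maximalRealSubfield L)) → ℂ) 0 ≠ 0 := by
    by_contra hall
    push Not at hall
    exact hf₁ne (eq_zero_of_forall_apply_zero_toRep_boxSB_left_eq_zero (maximalRealSubfield L) v 2 hTd m₀ hm₀ f₁ hall)
  obtain ⟨f₂, hf₂⟩ := hex
  set f₂' : SchwartzBruhat (Fin 2 → v.adicCompletion (maximalRealSubfield L)) :=
    (((MpPsi.toRep (localSchrodinger (maximalRealSubfield L) (2 + 2) (gramD (maximalRealSubfield L) 2 T) v) m₀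
          (boxSB (v.adicCompletion (maximalRealSubfield L)) (e₂ 2) f₁ f₂) :
            SchwartzBruhat (Fin (2 + 2) → v.adicCompletion (maximalRealSubfield L))) :
          (Fin (2 + 2) → v.adicCompletion (maximalRealSubfield L)) → ℂ) 0)⁻¹ • f₂ with hf₂'
  set Φ : SchwartzBruhat (Fin (2 + 2) → v.adicCompletion (maximalRealSubfield L)) :=
    boxSB (v.adicCompletion (maximalRealSubfield L)) (e₂ 2) f₁ f₂' with hΦ
  have hlamΦ : lam Φ = ((1 : ℝ) : ℂ) := by
    rw [hlam, hΦ, hf₂', boxSB_smul_right, map_smul, Submodule.coe_smul, Pi.smul_apply, smul_eq_mul, inv_mul_cancel₀ hf₂, Complex.ofReal_one]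
  -- the Siegel parabolic `P_Δ` of `G₁`, bundled
  let P : Subgroup (localPi L (IsCMField.complexConj L) (1 + 1) JD₁ v) :=
    { carrier := {h | IsSiegelDelta (maximalRealSubfield L) L (IsCMField.complexConj L) (complexConj_imagUnit L) (imagUnit_ne_zero L)
        (imagUnit_mul_self L) v 1 h1s hJD₁ h}
      mul_mem' := fun ha hb => ha.mul hb
      one_mem' := isSiegelDelta_one (maximalRealSubfield L) L (IsCMField.complexConj L) (complexConj_imagUnit L) (imagUnit_ne_zero L)
        (imagUnit_mul_self L) v 1 h1s hJD₁
      inv_mem' := fun ha => ha.inv }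
  have hP : ∀ h, h ∈ P ↔ IsSiegelDelta (maximalRealSubfield L) L (IsCMField.complexConj L) (complexConj_imagUnit L) (imagUnit_ne_zero L)
      (imagUnit_mul_self L) v 1 h1s hJD₁ h := fun _ => Iff.rfl
  -- the twist on `inl U(W)` is the centre character
  have hμ : ∀ u : localPi L (IsCMField.complexConj L) 1
      ((1 : Matrix (Fin 1) (Fin 1) (maximalRealSubfield L)).map (algebraMap (maximalRealSubfield L) L)) v,
      localMu L χ v (Matrix.GeneralLinearGroup.det ((localPiEquiv L (IsCMField.complexConj L) (1 + 1) JD₁ v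
        (inlLoc (maximalRealSubfield L) L (IsCMField.complexConj L) v 1 hJW hJD₁ u)).1)) =
        e' (UnitaryGroup.localCenter L (IsCMField.complexConj L) 1 J' _ hJW0 v u) := fun u => by
    rw [he']
    exact localMu_det_inlLoc_eq L v χ hJW hJW0 hJD₁ hJ'0 u
  -- the centre eigen-law read through `U(⟨1⟩)`
  have hcen : ∀ u : localPi L (IsCMField.complexConj L) 1
      ((1 : Matrix (Fin 1) (Fin 1) (maximalRealSubfield L)).map (algebraMap (maximalRealSubfield L) L)) v,
      MpPsi.toRep (localSchrodinger (maximalRealSubfield L) 2 T v)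
          (localSplittingCMWith L 2 hTs hTd (J := T.map (algebraMap (maximalRealSubfield L) L)) rfl χ hχ v μ
            (UnitaryGroup.localCenter L (IsCMField.complexConj L) 2 (T.map (algebraMap (maximalRealSubfield L) L)) _ hJW0 v u)) f₁ =
        ((e' (UnitaryGroup.localCenter L (IsCMField.complexConj L) 1 J' _ hJW0 v u) : ℂˣ) : ℂ) • f₁ := fun u => by
    rw [← localCenter_two_comp L v (T.map (algebraMap (maximalRealSubfield L) L)) hJ'0 hJW0 u]
    exact hf₁eig _
  -- `Φ` is fixed by the twisted section on `inl U(W)`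
  have hfixΦ : ∀ u : localPi L (IsCMField.complexConj L) 1
      ((1 : Matrix (Fin 1) (Fin 1) (maximalRealSubfield L)).map (algebraMap (maximalRealSubfield L) L)) v,
      (((localMu L χ v (Matrix.GeneralLinearGroup.det ((localPiEquiv L (IsCMField.complexConj L) (1 + 1) JD₁ v
          (inlLoc (maximalRealSubfield L) L (IsCMField.complexConj L) v 1 hJW hJD₁ u)).1)))⁻¹ : ℂˣ) : ℂ) •
        MpPsi.toRep (localSchrodinger (maximalRealSubfield L) (2 + 2) (gramD (maximalRealSubfield L) 2 T) v)
          ((localSplittingDatumCM L v μ 2 hTs hTd rfl χ hχ).localSplitting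
            (kronLoc (maximalRealSubfield L) L (IsCMField.complexConj L) v 2 (T := T) (J := T.map (algebraMap (maximalRealSubfield L) L))
              rfl rfl hJD₁ (inlLoc (maximalRealSubfield L) L (IsCMField.complexConj L) v 1 hJW hJD₁ u))) Φ = Φ := fun u => by
    rw [hΦ, toRep_localSplitting_kronLoc_inlLoc_boxSB L v μ χ hχ hTs hTd hJW hJW0 hJD₁ u f₁ f₂', hcen u, boxSB_smul_left, smul_smul, hμ u,
      ← Units.val_mul, inv_mul_cancel, Units.val_one, one_smul]
  -- THE DOCK (O2)
  obtain ⟨Λ, hΛinv, hΛpos⟩ := exists_invariant_functional_of_fixedVector_cm L v h1s h1d hJW hJD₁ P hP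
    (fun g => (((localMu L χ v (Matrix.GeneralLinearGroup.det ((localPiEquiv L (IsCMField.complexConj L) (1 + 1) JD₁ v g).1)))⁻¹ : ℂˣ) : ℂ) •
      MpPsi.toRep (localSchrodinger (maximalRealSubfield L) (2 + 2) (gramD (maximalRealSubfield L) 2 T) v)
        ((localSplittingDatumCM L v μ 2 hTs hTd rfl χ hχ).localSplitting
          (kronLoc (maximalRealSubfield L) L (IsCMField.complexConj L) v 2 (T := T) (J := T.map (algebraMap (maximalRealSubfield L) L))
            rfl rfl hJD₁ g)))
    lam Φ 1 hE
    (fun g g' Ψ => by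
      have hm := twistedSection_mul L v μ χ hχ hTs hTd
        (kronLoc (maximalRealSubfield L) L (IsCMField.complexConj L) v 2 (T := T) (J := T.map (algebraMap (maximalRealSubfield L) L))
          rfl rfl hJD₁) g g'
      have := congrArg (fun A : Module.End ℂ (SchwartzBruhat (Fin (2 + 2) → v.adicCompletion (maximalRealSubfield L))) => A Ψ) hm
      simpa only [Module.End.mul_apply] using this)
    (fun p Ψ => by
      haveI := locallyCompactSpace_of_isSiegelDelta (maximalRealSubfield L) L (IsCMField.complexConj L) (complexConj_imagUnit L)
        (imagUnit_ne_zero L) (imagUnit_mul_self L) v 1 h1s hJD₁ P hP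
      show lam _ = _ * lam Ψ
      rw [hlam, hlam, LinearMap.smul_apply]
      exact apply_zero_toRep_twistedSection_kronLoc_eq_modularCharacter_mul L v μ χ hχ hTs hTd hJD₁ h1s P hP m₀ hm₀ p Ψ)
    (fun Ψ => (continuous_apply_twistedSection_kronLoc L v μ χ hχ hTs hTd hJD₁ lam Ψ).congr fun h => by
      beta_reduce
      rw [LinearMap.smul_apply])
    (fun u => by
      rw [LinearMap.smul_apply]
      exact hfixΦ u)
    hlamΦ one_pos
  refine ⟨Λ, fun h0 => ?_, fun g Ψ => ?_⟩
  · rw [h0, LinearMap.zero_apply, Complex.zero_re] at hΛpos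
    exact lt_irrefl _ hΛpos
  · have hg := hΛinv g Ψ
    beta_reduce at hg
    rw [LinearMap.smul_apply] at hg
    exact hg

end Dock

/-! ## §4 (Z-Λ): a centre type gives a non-zero `U(W ⊕ −W)`-invariant functional -/
section Main
set_option synthInstance.maxHeartbeats 400000 in
set_option maxHeartbeats 8000000 in -- block-currency terms + the doubled CM datum's telescope
/-- **(Z-Λ) — THE BODY OF `ZLambda`** (★-to-be `Theorems/F0LD2SoftRoadZBricks.lean`, verbatim): at a non-split place, if the centre character `e′ = ∏_w χ_w ∘ det`
occurs in Kudla's CM Weil representation `ω_T ∘ s_T` of the plane `T` restricted to the centre, then some NON-ZERO linear functional on `𝒮(L⁺_v^{2+2})` is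
invariant under the twisted section `s′ h = μ_v(det h)⁻¹ • ω^𝔻(s^𝔻(h ⊗ₖ 1_V))` of the standard doubled line `U(⟨1⟩ ⊕ ⟨−1⟩)(L⁺_v)`: an `e′`-eigenvector
(★ `TwistedCoinv.exists_mem_weightSpace_mk_eq`; `U(J′)(L⁺_v)` compact through the centre homeomorphism, `ω_T ∘ s_T` smooth) and §3.
[cite: GelbartRogawski1991, §3.2 (3.2.2)–(3.2.3) p. 457] [cite: BernsteinZelevinsky1976, §2.3] [cite: MoeglinVignerasWaldspurger1987, Chap. 2 II.1 (B)] -/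
theorem zLambda_body :
    ∀ (L : Type) [Field L] [NumberField L] [IsCMField L] (v : HeightOneSpectrum (𝓞 (maximalRealSubfield L)))
    [MeasurableSpace (v.adicCompletion (maximalRealSubfield L))] [BorelSpace (v.adicCompletion (maximalRealSubfield L))]
    (μ : Measure (v.adicCompletion (maximalRealSubfield L))) [μ.IsAddHaarMeasure]
    (hE : IsField (UnitaryGroup.LocalRing L v))
    {T : Matrix (Fin (1 + 1)) (Fin (1 + 1)) (maximalRealSubfield L)} (hTs : T.IsSymm) (hTd : IsUnit T.det)
    {J : Matrix (Fin (1 + 1)) (Fin (1 + 1)) L} (hJ : J = T.map (algebraMap (maximalRealSubfield L) L))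
    (χ : HeckeCharacter L) (hχ : IsSplittingChar L 1 χ) {J₁ : Matrix (Fin 1) (Fin 1) L} {J' : Matrix (Fin 1) (Fin 1) L} (hJ'0 : J' 0 0 ≠ 0)
    (e' : localPi L (IsCMField.complexConj L) 1 J' v →* ℂˣ) (he'o : IsOpen (e'.ker : Set (localPi L (IsCMField.complexConj L) 1 J' v)))
    (he' : ∀ z, e' z = ∏ w' : PlacesOver L v, χ.localComponent w'.1 (Matrix.GeneralLinearGroup.det
      (((UnitaryGroup.localCenter L (IsCMField.complexConj L) 1 J₁ J' hJ'0 v z : localPi L (IsCMField.complexConj L) 1 J₁ v) :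
        LocalGLPi L 1 v) w')))
    {JD₁ : Matrix (Fin (1 + 1)) (Fin (1 + 1)) L}
    (hJD₁ : JD₁ = (gramD (maximalRealSubfield L) 1 1).map (algebraMap (maximalRealSubfield L) L)),
    Nontrivial (Coinv ((((MpPsi.toRep (localSchrodinger (maximalRealSubfield L) (1 + 1) T v)).comp
        (localSplittingCMWith L (1 + 1) hTs hTd hJ χ hχ v μ))).comp
        (UnitaryGroup.localCenter L (IsCMField.complexConj L) (1 + 1) J J' hJ'0 v)) e') →
    ∃ Λ : SchwartzBruhat (Fin (2 + 2) → v.adicCompletion (maximalRealSubfield L)) →ₗ[ℂ] ℂ, Λ ≠ 0 ∧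
      ∀ (g : UnitaryGroup.localPi L (IsCMField.complexConj L) (1 + 1) JD₁ v)
        (Ψ : SchwartzBruhat (Fin (2 + 2) → v.adicCompletion (maximalRealSubfield L))),
        Λ ((((localMu L χ v (Matrix.GeneralLinearGroup.det ((localPiEquiv L (IsCMField.complexConj L) (1 + 1) JD₁ v g).1)))⁻¹ : ℂˣ) : ℂ) •
          MpPsi.toRep (localSchrodinger (maximalRealSubfield L) (2 + 2) (gramD (maximalRealSubfield L) 2 T) v)
            ((localSplittingDatumCM L v μ 2 hTs hTd rfl χ hχ).localSplitting
              (kronLoc (maximalRealSubfield L) L (IsCMField.complexConj L) v 2 (T := T) (J := T.map (algebraMap (maximalRealSubfield L) L))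
                rfl rfl hJD₁ g)) Ψ) = Λ Ψ := by
  intro L _ _ _ v _ _ μ _ hE T hTs hTd J hJ χ hχ J₁ J' hJ'0 e' he'o he' JD₁ hJD₁ h
  subst hJ
  have hJW0 := one_map_apply_zero_ne_zero L
  have h1d : IsUnit (1 : Matrix (Fin 1) (Fin 1) (maximalRealSubfield L)).det := by
    rw [Matrix.det_one]; exact isUnit_one
  -- `U(⟨1⟩)(L⁺_v)` is compact (non-split `v`), hence so is `U(J′)(L⁺_v)` through the centre homeomorphism `z ↦ z`
  haveI hcW : CompactSpace (localPi L (IsCMField.complexConj L) 1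
      ((1 : Matrix (Fin 1) (Fin 1) (maximalRealSubfield L)).map (algebraMap (maximalRealSubfield L) L)) v) :=
    compactSpace_localPi_rankOne (maximalRealSubfield L) L (IsCMField.complexConj L) (complexConj_imagUnit L) (imagUnit_ne_zero L) h1d rfl v hE
  let eJ : localPi L (IsCMField.complexConj L) 1 J' v ≃*
      localPi L (IsCMField.complexConj L) 1 ((1 : Matrix (Fin 1) (Fin 1) (maximalRealSubfield L)).map (algebraMap (maximalRealSubfield L) L)) v :=
    { toFun := UnitaryGroup.localCenter L (IsCMField.complexConj L) 1 _ J' hJ'0 v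
      invFun := UnitaryGroup.localCenter L (IsCMField.complexConj L) 1 J' _ hJW0 v
      left_inv := fun z => localCenter_one_one_inverse L (IsCMField.complexConj L) _ J' hJW0 hJ'0 v z
      right_inv := fun z => localCenter_one_one_inverse L (IsCMField.complexConj L) J' _ hJ'0 hJW0 v z
      map_mul' := map_mul _ }
  have heJc : Continuous eJ := UnitaryGroup.continuous_localCenter L (IsCMField.complexConj L) 1 _ J' hJ'0 v
  have heJsc : Continuous eJ.symm := UnitaryGroup.continuous_localCenter L (IsCMField.complexConj L) 1 J' _ hJW0 v
  let eH : localPi L (IsCMField.complexConj L) 1 J' v ≃ₜ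
      localPi L (IsCMField.complexConj L) 1 ((1 : Matrix (Fin 1) (Fin 1) (maximalRealSubfield L)).map (algebraMap (maximalRealSubfield L) L)) v :=
    { eJ.toEquiv with continuous_toFun := heJc, continuous_invFun := heJsc }
  haveI : CompactSpace (localPi L (IsCMField.complexConj L) 1 J' v) := eH.symm.compactSpace
  -- the centre representation of the plane, read at rank `2`, and its smoothness
  set ρZ : Representation ℂ (localPi L (IsCMField.complexConj L) 1 J' v) (SchwartzBruhat (Fin 2 → v.adicCompletion (maximalRealSubfield L))) :=
    ((MpPsi.toRep (localSchrodinger (maximalRealSubfield L) 2 T v)).comp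
        (localSplittingCMWith L 2 hTs hTd (J := T.map (algebraMap (maximalRealSubfield L) L)) rfl χ hχ v μ)).comp
      (UnitaryGroup.localCenter L (IsCMField.complexConj L) 2 (T.map (algebraMap (maximalRealSubfield L) L)) J' hJ'0 v) with hρZ
  have h2 : Nontrivial (Coinv ρZ e') := h
  have hsm : ρZ.IsSmooth := fun Φ =>
    (isSmooth_localSplittingCMWith L 2 hTs hTd (J := T.map (algebraMap (maximalRealSubfield L) L)) rfl χ hχ v μ Φ).preimage
      (UnitaryGroup.continuous_localCenter L (IsCMField.complexConj L) 2 (T.map (algebraMap (maximalRealSubfield L) L)) J' hJ'0 v)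
  -- an `e′`-eigenvector `f₁ ≠ 0`
  obtain ⟨x, hx⟩ := exists_ne (0 : Coinv ρZ e')
  obtain ⟨w, rfl⟩ := TwistedCoinv.mk_surjective ρZ e' x
  obtain ⟨f₁, hf₁w, hmk⟩ := TwistedCoinv.exists_mem_weightSpace_mk_eq ρZ e' hsm he'o w
  have hf₁ne : f₁ ≠ 0 := fun h0 => hx (by rw [← hmk, h0, map_zero])
  rw [mem_weightSpace] at hf₁w
  exact exists_invariant_functional_of_centre_eigenvector L v μ hE hTs hTd χ hχ hJ'0 e' he' hJD₁ f₁ hf₁ne fun z => hf₁w z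

end Main

end Summit.HodgeConjecture.HodgeConjecture.Cruxes.HLiu418.F0LD2SoftRoadZLambda

end
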